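import Summits.RiemannHypothesis.RiemannHypothesis.Theses.OddSector
import Summits.RiemannHypothesis.RiemannHypothesis.Theorems.WeilRouteProps.OddSector

/-!
# `Iff.rfl` bridges: Theses-free copies ↔ route propositions (route `OddSector`)

LEAF module (imports the route file; nothing imports this): for every statement item `X` of route `OddSector` the copy
`Summit.RiemannHypothesis.RiemannHypothesis.Theorems.WeilRouteProps.OddSector.X` and the route declaration
`Summit.RiemannHypothesis.RiemannHypothesis.Theses.OddSector.X` are the same proposition, by `Iff.rfl` (definitional unfolding).
If a route statement is ever restated, this file stops elaborating — the signal to re-sync the copy. Build refactor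
(21-frontier 2026-08-26T18:52:29Z); nothing here bears on the truth of RH.
-/

namespace Summit.RiemannHypothesis.RiemannHypothesis.Theorems.WeilRouteProps.OddSector

/-- The Theses-free copy `WeilRouteProps.OddSector.OddOneSignedWindows` IS the route proposition `Theses.OddSector.OddOneSignedWindows` (item stmt-RiemannHypothesis-17778):
definitional unfolding (`Iff.rfl`). -/
theorem OddOneSignedWindows_iff :
    OddOneSignedWindows ↔ Summit.RiemannHypothesis.RiemannHypothesis.Theses.OddSector.OddOneSignedWindows :=
  Iff.rfl

/-- The Theses-free copy `WeilRouteProps.OddSector.OddBartaFloor` IS the route proposition `Theses.OddSector.OddBartaFloor` (item stmt-RiemannHypothesis-17779):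
definitional unfolding (`Iff.rfl`). -/
theorem OddBartaFloor_iff :
    OddBartaFloor ↔ Summit.RiemannHypothesis.RiemannHypothesis.Theses.OddSector.OddBartaFloor :=
  Iff.rfl

/-- The Theses-free copy `WeilRouteProps.OddSector.OddNegativityOffLine` IS the route proposition `Theses.OddSector.OddNegativityOffLine` (item stmt-RiemannHypothesis-17780):
definitional unfolding (`Iff.rfl`). -/
theorem OddNegativityOffLine_iff :
    OddNegativityOffLine ↔ Summit.RiemannHypothesis.RiemannHypothesis.Theses.OddSector.OddNegativityOffLine :=
  Iff.rfl

/-- The Theses-free copy `WeilRouteProps.OddSector.OddArchAnchor` IS the route proposition `Theses.OddSector.OddArchAnchor` (item stmt-RiemannHypothesis-17781):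
definitional unfolding (`Iff.rfl`). -/
theorem OddArchAnchor_iff :
    OddArchAnchor ↔ Summit.RiemannHypothesis.RiemannHypothesis.Theses.OddSector.OddArchAnchor :=
  Iff.rfl

/-- The Theses-free copy `WeilRouteProps.OddSector.Assembly` IS the route proposition `Theses.OddSector.Assembly` (item stmt-RiemannHypothesis-17364):
definitional unfolding (`Iff.rfl`). -/
theorem Assembly_iff :
    Assembly ↔ Summit.RiemannHypothesis.RiemannHypothesis.Theses.OddSector.Assembly :=
  Iff.rfl

end Summit.RiemannHypothesis.RiemannHypothesis.Theorems.WeilRouteProps.OddSector
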